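import Mathlib
import HarnessLib
import Summits.HubbardSuperconductivity.HubbardSuperconductivity.Theorems.KLProgrammeKLRegimeEnginePairTransferDLineTwoShell

/-!
# Route `KLProgramme` — ENGINE child gen 8 (stmt-HubbardSuperconductivity-20437 `KLRegimeEngineV17F2`), skeleton v2 class #5 rev 3: the CROSSED `D`-line mass
# `WDx` of `klmd_defectDiff_le_masses_family` for a DEEP pair, above the small-transfer threshold — the two-shell law at transfer `x + y − Q_m`
# (cell gate-hubbard-kl, seat hubbard-kl-k3c2-p2 g16; KLTC-INDEX v10.3 §D rows «k3c2-p2»; companion of `…PairTransferDLineTwoShell`)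

WHY.  The crossed row differs from the direct one (`WDd_sum_le_twoShell`) in two places only: the momentum transfer is `q′ = Q_m − x − y` and the partner
frequency is shifted by the bosonic quantum, `m_{p′} + 1 = m_p` — so `p ↦ p′` is NOT a bijection of the finite frequency window.  The cure is to bound each
product separately and to collapse, for the mirrored product, the `p`-sum at fixed `p′` (at most ONE `p` matches: integer labels are injective):
* §1 `crossProd_le_indicator` — `|D(p)|·βL²‖ĝ(p)‖·|ẇ_Λ(p′)|·βL²‖ĝ(p′)‖ ≤ (βL²)²(128/(3Λ²))·[ρ(p)² ≤ Λ_{j′}² ∧ |e_K(k′)| ≤ Λ]·ρ(p)⁻¹` for ANY partner `p′`;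
  `card_partner_le_one`, `card_source_le_one`, `sum_ite_le_of_card_le_one`;
* §2 **`WDx_sum_le_twoShell`** (+ `_klTS`) — deep pair `n + 2 ≤ j′ ≤ j`, `t ∈ [0,1]`, `Λₙ + Gδ ≤ klE0`, `0 < r ≤ |x + y − Q_m|_𝕋`:
  `WDx(t,x,y) ≤ (256/3)·(βL²)²/Λ(t)²·(9AL²/(2π²))·((Λ(t)+Gδ)/r + √(Λ(t)+Gδ))·[(βΛ_{j′}/π)(10 + 2Gβ/L) + 12Gβ/L]`
  — the ROOM's `min(·, Λₙ₊₁/|k+k′−Q_m|)` and `2⁻ⁿ` slots times `klIdxMass n j′`.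
Plumbing over the companions; nothing about the model's kernel sizes is asserted; nothing asserts (X).3, (c), K3 or superconductivity.  0 kit · 0 lit.
-/

noncomputable section

namespace Summit.HubbardSuperconductivity.HubbardSuperconductivity.Theorems.KLRegimeSplit

set_option linter.dupNamespace false -- summit = problem name (single-conjunct summit), D-0017

open Real Finset Set Literature.MathematicalPhysics.QuantumLattice Literature.Probability.LatticeModels
open Literature.MathematicalPhysics.QuantumLattice.FermiRG
open Summit.HubbardSuperconductivity.HubbardSuperconductivity.Theorems.KLProgrammeLegKernels
open Summit.HubbardSuperconductivity.HubbardSuperconductivity.Theorems.TwoPointAssembly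
open Summit.HubbardSuperconductivity.HubbardSuperconductivity.Theorems.DispersionFlow
open Summit.HubbardSuperconductivity.HubbardSuperconductivity.Theorems.KLRegimeWick
open Summit.HubbardSuperconductivity.HubbardSuperconductivity.Theorems.EngineV8

variable {L M : ℕ} (β μ : ℝ) (K : TrigPolyC4v)

/-! ## §1 One product against the indicator, for any partner; the partner / source fibres have at most one element -/

/-- **One product against the weighted indicator, any partner**: for `j′ ≤ j`, `0 < Λ` and ANY `p, p′`,
`|D(p)|·(βL²‖ĝ(p)‖)·(|ẇ_Λ(p′)|·(βL²‖ĝ(p′)‖)) ≤ (βL²)²·(128/(3Λ²))·[ρ(p)² ≤ Λ_{j′}² ∧ |e_K(k_{p′})| ≤ Λ]·ρ(p)⁻¹`. -/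
theorem crossProd_le_indicator [NeZero L] {β : ℝ} (hβ : 0 < β) (μ : ℝ) (K : TrigPolyC4v) (n : ℕ) {j j' : ℕ} (hjj : j' ≤ j) {Λ : ℝ} (hΛ : 0 < Λ)
    (p p' : FreqMomentum L M) :
    |softSymbolCompl L M β μ K (n + 1) j p - softSymbolCompl L M β μ K (n + 1) j' p| * ((β * (L : ℝ) ^ 2) * ‖propCT L M β μ K p‖) *
        (|deriv (fun Λ' : ℝ => hubbardCutoffWeightCT L M β μ K Λ' p') Λ| * ((β * (L : ℝ) ^ 2) * ‖propCT L M β μ K p'‖)) ≤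
      (β * (L : ℝ) ^ 2) ^ 2 * (128 / (3 * Λ ^ 2)) *
        (if matsubaraFreq β M p.1 ^ 2 + nambuXiCT L μ K p.2 ^ 2 ≤ klScale klE0 j' ^ 2 ∧ |nambuXiCT L μ K p'.2| ≤ Λ then
          (Real.sqrt (matsubaraFreq β M p.1 ^ 2 + nambuXiCT L μ K p.2 ^ 2))⁻¹ else 0) := by
  have hβL : 0 < β * (L : ℝ) ^ 2 := by
    have : (0 : ℝ) < L := by exact_mod_cast Nat.pos_of_ne_zero (NeZero.ne L)
    positivity
  by_cases hD : softSymbolCompl L M β μ K (n + 1) j p - softSymbolCompl L M β μ K (n + 1) j' p = 0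
  · rw [hD, abs_zero, zero_mul, zero_mul]
    split_ifs <;> positivity
  by_cases hW : deriv (fun Λ' : ℝ => hubbardCutoffWeightCT L M β μ K Λ' p') Λ = 0
  · rw [hW, abs_zero, zero_mul, mul_zero]
    split_ifs <;> positivity
  have hrad := radius_lt_of_dLine_ne_zero β μ K n hjj p hD
  have he := abs_nambuXiCT_le_of_slice_ne_zero β μ K hΛ p' hW
  rw [if_pos ⟨hrad.le, he⟩]
  have h1 : |softSymbolCompl L M β μ K (n + 1) j p - softSymbolCompl L M β μ K (n + 1) j' p| ≤ 1 := abs_dLine_le_one β μ K n hjj p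
  have h2 := slice_factor_le β μ K hΛ p'
  have h3 : ‖propCT L M β μ K p‖ = (Real.sqrt (matsubaraFreq β M p.1 ^ 2 + nambuXiCT L μ K p.2 ^ 2))⁻¹ := norm_propCT_eq (L := L) (M := M) (β := β) (μ := μ) (K := K) p
  rw [← h3]
  have hn : 0 ≤ ‖propCT L M β μ K p‖ := norm_nonneg _
  calc _ = (|softSymbolCompl L M β μ K (n + 1) j p - softSymbolCompl L M β μ K (n + 1) j' p|) *
        (|deriv (fun Λ' : ℝ => hubbardCutoffWeightCT L M β μ K Λ' p') Λ| * ‖propCT L M β μ K p'‖) * ((β * (L : ℝ) ^ 2) ^ 2 * ‖propCT L M β μ K p‖) := by ring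
    _ ≤ 1 * (128 / (3 * Λ ^ 2)) * ((β * (L : ℝ) ^ 2) ^ 2 * ‖propCT L M β μ K p‖) := by gcongr
    _ = _ := by ring

omit β μ K in
/-- **A sum of nonnegative `ite`s over a fibre with at most one element** is at most the common bound. -/
theorem sum_ite_le_of_card_le_one {α : Type*} (s : Finset α) (c : α → Prop) [DecidablePred c] (f : α → ℝ) {b : ℝ} (hb : 0 ≤ b)
    (hf : ∀ a ∈ s, c a → f a ≤ b) (hcard : (s.filter c).card ≤ 1) :
    (∑ a ∈ s, if c a then f a else 0) ≤ b := by
  rw [← Finset.sum_filter]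
  calc ∑ a ∈ s.filter c, f a ≤ ∑ _a ∈ s.filter c, b := Finset.sum_le_sum fun a ha => hf a (mem_filter.1 ha).1 (mem_filter.1 ha).2
    _ = (s.filter c).card • b := by rw [Finset.sum_const]
    _ ≤ b := by
        rw [nsmul_eq_mul]
        rcases Nat.le_one_iff_eq_zero_or_eq_one.1 hcard with h | h <;> simp [h, hb]

omit β μ K in
/-- The crossed partner fibre has at most one element: `m_{p′} + 2m₀ + 1 = m_p ∧ k′ = k + Q_m − x − y` determines `p′`. -/
theorem card_partner_le_one [NeZero L] [NeZero M] (Qm x y : TorusSite 2 L) (p : FreqMomentum L M) :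
    (univ.filter fun p' : FreqMomentum L M =>
        matsubaraInt M p'.1 + matsubaraInt M (omega0 M) + matsubaraInt M (omega0 M) + 1 = matsubaraInt M p.1 ∧ p'.2 = p.2 + Qm - x - y).card ≤ 1 := by
  refine Finset.card_le_one.2 fun a ha b hb => ?_
  obtain ⟨ha1, ha2⟩ := (mem_filter.1 ha).2
  obtain ⟨hb1, hb2⟩ := (mem_filter.1 hb).2
  exact Prod.ext (matsubaraIdx_eq_of_matsubaraInt_eq (by linarith)) (by rw [ha2, hb2])

omit β μ K in
/-- The crossed source fibre has at most one element: at fixed `p′` the constraint determines `p`. -/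
theorem card_source_le_one [NeZero L] [NeZero M] (Qm x y : TorusSite 2 L) (p' : FreqMomentum L M) :
    (univ.filter fun p : FreqMomentum L M =>
        matsubaraInt M p'.1 + matsubaraInt M (omega0 M) + matsubaraInt M (omega0 M) + 1 = matsubaraInt M p.1 ∧ p'.2 = p.2 + Qm - x - y).card ≤ 1 := by
  refine Finset.card_le_one.2 fun a ha b hb => ?_
  obtain ⟨ha1, ha2⟩ := (mem_filter.1 ha).2
  obtain ⟨hb1, hb2⟩ := (mem_filter.1 hb).2
  refine Prod.ext (matsubaraIdx_eq_of_matsubaraInt_eq (by linarith)) ?_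
  have h2 : a.2 + Qm - x - y = b.2 + Qm - x - y := by rw [← ha2, ← hb2]
  have ea : a.2 = (a.2 + Qm - x - y) - Qm + x + y := by abel
  have eb : b.2 = (b.2 + Qm - x - y) - Qm + x + y := by abel
  rw [ea, eb, h2]

/-! ## §2 The crossed `D`-row above threshold: the two-shell law at transfer `x + y − Q_m` -/

/-- **`WDx ≤` the weighted two-shell mass, for a deep pair.**  For `TwoShellFrameAreaAt A u` (`0 ≤ A`), `R.WF2`, `0 < U ≤ u R`, `μ ∈ klWindowC`,
`FrameOK R U N μ K`, `0 < β`, `n + 2 ≤ j′ ≤ j`, `t ∈ [0,1]`, `Λₙ + Gδ ≤ klE0` and `0 < r ≤ |x + y − Q_m|_𝕋`: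
`WDx(t,x,y) ≤ (256/3)·(βL²)²/Λ(t)²·(9AL²/(2π²))·((Λ(t)+Gδ)/r + √(Λ(t)+Gδ))·[(βΛ_{j′}/π)(10 + 2Gβ/L) + 12Gβ/L]`
(the literal crossed `D`-mass of `klmd_defectDiff_le_masses_family`). -/
theorem WDx_sum_le_twoShell [NeZero L] [NeZero M] {A : ℝ} {u : RenConsts → ℝ} (h : TwoShellFrameAreaAt A u) (hA : 0 ≤ A) {R : RenConsts}
    (hR : R.WF2) {U : ℝ} (hU : 0 < U) (hUu : U ≤ u R) (hμ : μ ∈ klWindowC) {N : ℕ} (hK : FrameOK R U N μ K) (hβ : 0 < β)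
    (n : ℕ) {j j' : ℕ} (hj' : n + 2 ≤ j') (hjj : j' ≤ j) {t : ℝ} (ht : t ∈ Icc (0 : ℝ) 1)
    (hE0 : klScale klE0 n + (4 + 8 / 3 * R.Gfr 1 * U ^ 2) * (2 * π / L) ≤ klE0) {Qm x y : TorusSite 2 L} {r : ℝ} (hr : 0 < r)
    (hrw : r ≤ klTorusNorm L (x + y - Qm)) :
    ∑ p : FreqMomentum L M, ∑ p' : FreqMomentum L M,
      (if matsubaraInt M p'.1 + matsubaraInt M (omega0 M) + matsubaraInt M (omega0 M) + 1 = matsubaraInt M p.1 ∧ p'.2 = p.2 + Qm - x - y then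
        ‖((((softSymbolCompl L M β μ K (n + 1) j p - softSymbolCompl L M β μ K (n + 1) j' p : ℝ)) : ℂ) * (((β * (L : ℝ) ^ 2 : ℝ) : ℂ) * propCT L M β μ K p)) *
            ((((deriv (fun Λ' : ℝ => hubbardCutoffWeightCT L M β μ K Λ' p') (klScale klE0 n + t * (klScale klE0 (n + 1) - klScale klE0 n)) : ℝ)) : ℂ) *
              (((β * (L : ℝ) ^ 2 : ℝ) : ℂ) * propCT L M β μ K p')) +
          ((((deriv (fun Λ' : ℝ => hubbardCutoffWeightCT L M β μ K Λ' p) (klScale klE0 n + t * (klScale klE0 (n + 1) - klScale klE0 n)) : ℝ)) : ℂ) *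
              (((β * (L : ℝ) ^ 2 : ℝ) : ℂ) * propCT L M β μ K p)) *
            ((((softSymbolCompl L M β μ K (n + 1) j p' - softSymbolCompl L M β μ K (n + 1) j' p' : ℝ)) : ℂ) * (((β * (L : ℝ) ^ 2 : ℝ) : ℂ) * propCT L M β μ K p'))‖
      else 0) ≤
      256 / 3 * (β * (L : ℝ) ^ 2) ^ 2 / (klScale klE0 n + t * (klScale klE0 (n + 1) - klScale klE0 n)) ^ 2 *
        (9 * A * (L : ℝ) ^ 2 / (2 * π ^ 2) *
          (((klScale klE0 n + t * (klScale klE0 (n + 1) - klScale klE0 n)) + (4 + 8 / 3 * R.Gfr 1 * U ^ 2) * (2 * π / L)) / r +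
            Real.sqrt ((klScale klE0 n + t * (klScale klE0 (n + 1) - klScale klE0 n)) + (4 + 8 / 3 * R.Gfr 1 * U ^ 2) * (2 * π / L))) *
          (β * klScale klE0 j' / π * (10 + 2 * (4 + 8 / 3 * R.Gfr 1 * U ^ 2) * β / L) + 12 * (4 + 8 / 3 * R.Gfr 1 * U ^ 2) * β / L)) := by
  classical
  set Λ : ℝ := klScale klE0 n + t * (klScale klE0 (n + 1) - klScale klE0 n) with hΛdef
  have hΛ : 0 < Λ := scaleAt_pos n ht
  have hβL : 0 < β * (L : ℝ) ^ 2 := by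
    have : (0 : ℝ) < L := by exact_mod_cast Nat.pos_of_ne_zero (NeZero.ne L)
    positivity
  set G : ℝ := 4 + 8 / 3 * R.Gfr 1 * U ^ 2 with hG
  set q : TorusSite 2 L := Qm - x - y with hq
  have hj'0 := klth_klScale_pos j'
  have h2Λ : 2 * klScale klE0 j' ≤ Λ := by have := klScale_le_quarter_scaleAt hj' ht; rw [← hΛdef] at this; linarith
  have hE : Λ + G * (2 * π / L) ≤ klE0 := by have := (scaleAt_mem n ht).2; rw [← hΛdef] at this; linarith
  set W : ℝ := 9 * A * (L : ℝ) ^ 2 / (2 * π ^ 2) * ((Λ + G * (2 * π / L)) / r + Real.sqrt (Λ + G * (2 * π / L))) *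
      (β * klScale klE0 j' / π * (10 + 2 * G * β / L) + 12 * G * β / L) with hW
  have hrq : r ≤ klTorusNorm L q := by rw [hq, show Qm - x - y = -(x + y - Qm) by abel, klvr_klTorusNorm_neg]; exact hrw
  have hrnq : r ≤ klTorusNorm L (-q) := by rw [hq, show -(Qm - x - y) = x + y - Qm by abel]; exact hrw
  have hWq : ∑ p ∈ univ.filter (fun p : FreqMomentum L M => matsubaraFreq β M p.1 ^ 2 + nambuXiCT L μ K p.2 ^ 2 ≤ klScale klE0 j' ^ 2 ∧
      |nambuXiCT L μ K (p.2 - q)| ≤ Λ), (Real.sqrt (matsubaraFreq β M p.1 ^ 2 + nambuXiCT L μ K p.2 ^ 2))⁻¹ ≤ W :=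
    twoShell_weighted_sum_le h hA hR hU hUu hμ hK hβ hj'0 h2Λ hE q hr hrq
  have hWnq : ∑ p ∈ univ.filter (fun p : FreqMomentum L M => matsubaraFreq β M p.1 ^ 2 + nambuXiCT L μ K p.2 ^ 2 ≤ klScale klE0 j' ^ 2 ∧
      |nambuXiCT L μ K (p.2 - -q)| ≤ Λ), (Real.sqrt (matsubaraFreq β M p.1 ^ 2 + nambuXiCT L μ K p.2 ^ 2))⁻¹ ≤ W :=
    twoShell_weighted_sum_le h hA hR hU hUu hμ hK hβ hj'0 h2Λ hE (-q) hr hrnq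
  have hW0 : 0 ≤ W := le_trans (Finset.sum_nonneg fun p _ => inv_nonneg.2 (Real.sqrt_nonneg _)) hWq
  -- abbreviations
  set D : FreqMomentum L M → ℝ := fun p => softSymbolCompl L M β μ K (n + 1) j p - softSymbolCompl L M β μ K (n + 1) j' p with hDdef
  set Wd : FreqMomentum L M → ℝ := fun p => deriv (fun Λ' : ℝ => hubbardCutoffWeightCT L M β μ K Λ' p) Λ with hWddef
  set c : FreqMomentum L M → FreqMomentum L M → Prop := fun p p' =>
    matsubaraInt M p'.1 + matsubaraInt M (omega0 M) + matsubaraInt M (omega0 M) + 1 = matsubaraInt M p.1 ∧ p'.2 = p.2 + Qm - x - y with hc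
  set C0 : ℝ := (β * (L : ℝ) ^ 2) ^ 2 * (128 / (3 * Λ ^ 2)) with hC0
  have hC00 : 0 ≤ C0 := by positivity
  -- the two indicator functions
  set gA : FreqMomentum L M → ℝ := fun p => if matsubaraFreq β M p.1 ^ 2 + nambuXiCT L μ K p.2 ^ 2 ≤ klScale klE0 j' ^ 2 ∧
      |nambuXiCT L μ K (p.2 + q)| ≤ Λ then (Real.sqrt (matsubaraFreq β M p.1 ^ 2 + nambuXiCT L μ K p.2 ^ 2))⁻¹ else 0 with hgA
  set gB : FreqMomentum L M → ℝ := fun p' => if matsubaraFreq β M p'.1 ^ 2 + nambuXiCT L μ K p'.2 ^ 2 ≤ klScale klE0 j' ^ 2 ∧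
      |nambuXiCT L μ K (p'.2 - q)| ≤ Λ then (Real.sqrt (matsubaraFreq β M p'.1 ^ 2 + nambuXiCT L μ K p'.2 ^ 2))⁻¹ else 0 with hgB
  have hgA0 : ∀ p, 0 ≤ gA p := fun p => by simp only [hgA]; split_ifs <;> positivity
  have hgB0 : ∀ p, 0 ≤ gB p := fun p => by simp only [hgB]; split_ifs <;> positivity
  -- step 1: split the summand
  have hsplit : ∀ p p' : FreqMomentum L M,
      (if c p p' then ‖(((D p : ℝ) : ℂ) * (((β * (L : ℝ) ^ 2 : ℝ) : ℂ) * propCT L M β μ K p)) * (((Wd p' : ℝ) : ℂ) * (((β * (L : ℝ) ^ 2 : ℝ) : ℂ) * propCT L M β μ K p')) +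
          (((Wd p : ℝ) : ℂ) * (((β * (L : ℝ) ^ 2 : ℝ) : ℂ) * propCT L M β μ K p)) * (((D p' : ℝ) : ℂ) * (((β * (L : ℝ) ^ 2 : ℝ) : ℂ) * propCT L M β μ K p'))‖ else 0) ≤
      (if c p p' then |D p| * ((β * (L : ℝ) ^ 2) * ‖propCT L M β μ K p‖) * (|Wd p'| * ((β * (L : ℝ) ^ 2) * ‖propCT L M β μ K p'‖)) else 0) +
      (if c p p' then |D p'| * ((β * (L : ℝ) ^ 2) * ‖propCT L M β μ K p'‖) * (|Wd p| * ((β * (L : ℝ) ^ 2) * ‖propCT L M β μ K p‖)) else 0) := by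
    intro p p'
    split_ifs with hcc
    · refine (norm_add_le _ _).trans (add_le_add (le_of_eq (norm_weightProd_eq hβ μ K _ _ p p')) (le_of_eq ?_))
      rw [norm_weightProd_eq hβ μ K]; ring
    · simp
  -- step 2: part A — collapse the partner sum at fixed `p`
  have hA' : ∀ p : FreqMomentum L M,
      (∑ p' : FreqMomentum L M, if c p p' then |D p| * ((β * (L : ℝ) ^ 2) * ‖propCT L M β μ K p‖) * (|Wd p'| * ((β * (L : ℝ) ^ 2) * ‖propCT L M β μ K p'‖)) else 0) ≤
      C0 * gA p := by
    intro p
    refine sum_ite_le_of_card_le_one _ _ _ (mul_nonneg hC00 (hgA0 p)) (fun p' _ hcc => ?_) (card_partner_le_one Qm x y p)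
    have hb := crossProd_le_indicator hβ μ K n hjj hΛ p p'
    have e : p'.2 = p.2 + q := by rw [hcc.2, hq]; abel
    rw [e] at hb
    exact hb
  -- step 3: part B — collapse the source sum at fixed `p′`
  have hB' : ∀ p' : FreqMomentum L M,
      (∑ p : FreqMomentum L M, if c p p' then |D p'| * ((β * (L : ℝ) ^ 2) * ‖propCT L M β μ K p'‖) * (|Wd p| * ((β * (L : ℝ) ^ 2) * ‖propCT L M β μ K p‖)) else 0) ≤
      C0 * gB p' := by
    intro p'
    refine sum_ite_le_of_card_le_one _ (fun p => c p p') _ (mul_nonneg hC00 (hgB0 p')) (fun p _ hcc => ?_) (card_source_le_one Qm x y p')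
    have hb := crossProd_le_indicator hβ μ K n hjj hΛ p' p
    have e : p.2 = p'.2 - q := by rw [hcc.2, hq]; abel
    rw [e] at hb
    exact hb
  -- step 4: the two weighted sums
  have hSA : ∑ p : FreqMomentum L M, gA p ≤ W := by
    rw [hgA, ← Finset.sum_filter]
    have e : (univ.filter fun p : FreqMomentum L M => matsubaraFreq β M p.1 ^ 2 + nambuXiCT L μ K p.2 ^ 2 ≤ klScale klE0 j' ^ 2 ∧
        |nambuXiCT L μ K (p.2 + q)| ≤ Λ) = univ.filter fun p : FreqMomentum L M => matsubaraFreq β M p.1 ^ 2 + nambuXiCT L μ K p.2 ^ 2 ≤ klScale klE0 j' ^ 2 ∧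
        |nambuXiCT L μ K (p.2 - -q)| ≤ Λ := by
      congr 1; funext p; rw [sub_neg_eq_add]
    rw [e]; exact hWnq
  have hSB : ∑ p : FreqMomentum L M, gB p ≤ W := by
    rw [hgB, ← Finset.sum_filter]; exact hWq
  -- assemble
  calc _ ≤ ∑ p : FreqMomentum L M, ∑ p' : FreqMomentum L M,
        ((if c p p' then |D p| * ((β * (L : ℝ) ^ 2) * ‖propCT L M β μ K p‖) * (|Wd p'| * ((β * (L : ℝ) ^ 2) * ‖propCT L M β μ K p'‖)) else 0) +
         (if c p p' then |D p'| * ((β * (L : ℝ) ^ 2) * ‖propCT L M β μ K p'‖) * (|Wd p| * ((β * (L : ℝ) ^ 2) * ‖propCT L M β μ K p‖)) else 0)) :=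
        Finset.sum_le_sum fun p _ => Finset.sum_le_sum fun p' _ => hsplit p p'
    _ = ∑ p : FreqMomentum L M, ∑ p' : FreqMomentum L M,
          (if c p p' then |D p| * ((β * (L : ℝ) ^ 2) * ‖propCT L M β μ K p‖) * (|Wd p'| * ((β * (L : ℝ) ^ 2) * ‖propCT L M β μ K p'‖)) else 0) +
        ∑ p' : FreqMomentum L M, ∑ p : FreqMomentum L M,
          (if c p p' then |D p'| * ((β * (L : ℝ) ^ 2) * ‖propCT L M β μ K p'‖) * (|Wd p| * ((β * (L : ℝ) ^ 2) * ‖propCT L M β μ K p‖)) else 0) := by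
        rw [Finset.sum_comm (f := fun p' p => if c p p' then |D p'| * ((β * (L : ℝ) ^ 2) * ‖propCT L M β μ K p'‖) *
          (|Wd p| * ((β * (L : ℝ) ^ 2) * ‖propCT L M β μ K p‖)) else 0), ← Finset.sum_add_distrib]
        exact Finset.sum_congr rfl fun p _ => Finset.sum_add_distrib
    _ ≤ ∑ p : FreqMomentum L M, C0 * gA p + ∑ p' : FreqMomentum L M, C0 * gB p' := add_le_add (Finset.sum_le_sum fun p _ => hA' p) (Finset.sum_le_sum fun p' _ => hB' p')
    _ = C0 * (∑ p : FreqMomentum L M, gA p + ∑ p' : FreqMomentum L M, gB p') := by rw [mul_add, Finset.mul_sum, Finset.mul_sum]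
    _ ≤ C0 * (W + W) := by gcongr
    _ = 256 / 3 * (β * (L : ℝ) ^ 2) ^ 2 / Λ ^ 2 * W := by rw [hC0]; field_simp; ring

/-- **The package instance** (`A = klTS`, `u = klTSU`). -/
theorem WDx_sum_le_twoShell_klTS [NeZero L] [NeZero M] {R : RenConsts} (hR : R.WF2) {U : ℝ} (hU : 0 < U) (hUu : U ≤ klTSU R)
    (hμ : μ ∈ klWindowC) {N : ℕ} (hK : FrameOK R U N μ K) (hβ : 0 < β) (n : ℕ) {j j' : ℕ} (hj' : n + 2 ≤ j') (hjj : j' ≤ j) {t : ℝ}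
    (ht : t ∈ Icc (0 : ℝ) 1) (hE0 : klScale klE0 n + (4 + 8 / 3 * R.Gfr 1 * U ^ 2) * (2 * π / L) ≤ klE0) {Qm x y : TorusSite 2 L} {r : ℝ}
    (hr : 0 < r) (hrw : r ≤ klTorusNorm L (x + y - Qm)) :
    ∑ p : FreqMomentum L M, ∑ p' : FreqMomentum L M,
      (if matsubaraInt M p'.1 + matsubaraInt M (omega0 M) + matsubaraInt M (omega0 M) + 1 = matsubaraInt M p.1 ∧ p'.2 = p.2 + Qm - x - y then
        ‖((((softSymbolCompl L M β μ K (n + 1) j p - softSymbolCompl L M β μ K (n + 1) j' p : ℝ)) : ℂ) * (((β * (L : ℝ) ^ 2 : ℝ) : ℂ) * propCT L M β μ K p)) *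
            ((((deriv (fun Λ' : ℝ => hubbardCutoffWeightCT L M β μ K Λ' p') (klScale klE0 n + t * (klScale klE0 (n + 1) - klScale klE0 n)) : ℝ)) : ℂ) *
              (((β * (L : ℝ) ^ 2 : ℝ) : ℂ) * propCT L M β μ K p')) +
          ((((deriv (fun Λ' : ℝ => hubbardCutoffWeightCT L M β μ K Λ' p) (klScale klE0 n + t * (klScale klE0 (n + 1) - klScale klE0 n)) : ℝ)) : ℂ) *
              (((β * (L : ℝ) ^ 2 : ℝ) : ℂ) * propCT L M β μ K p)) *
            ((((softSymbolCompl L M β μ K (n + 1) j p' - softSymbolCompl L M β μ K (n + 1) j' p' : ℝ)) : ℂ) * (((β * (L : ℝ) ^ 2 : ℝ) : ℂ) * propCT L M β μ K p'))‖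
      else 0) ≤
      256 / 3 * (β * (L : ℝ) ^ 2) ^ 2 / (klScale klE0 n + t * (klScale klE0 (n + 1) - klScale klE0 n)) ^ 2 *
        (9 * klTS * (L : ℝ) ^ 2 / (2 * π ^ 2) *
          (((klScale klE0 n + t * (klScale klE0 (n + 1) - klScale klE0 n)) + (4 + 8 / 3 * R.Gfr 1 * U ^ 2) * (2 * π / L)) / r +
            Real.sqrt ((klScale klE0 n + t * (klScale klE0 (n + 1) - klScale klE0 n)) + (4 + 8 / 3 * R.Gfr 1 * U ^ 2) * (2 * π / L))) *
          (β * klScale klE0 j' / π * (10 + 2 * (4 + 8 / 3 * R.Gfr 1 * U ^ 2) * β / L) + 12 * (4 + 8 / 3 * R.Gfr 1 * U ^ 2) * β / L)) :=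
  WDx_sum_le_twoShell β μ K twoShellFrameAreaAt_klTS klTS_nonneg hR hU hUu hμ hK hβ n hj' hjj ht hE0 hr hrw

end Summit.HubbardSuperconductivity.HubbardSuperconductivity.Theorems.KLRegimeSplit

end
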